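import Summits.CriticalPhenomena.PercolationContinuityZ3.Theorems.PercNearOneGluingNoHeavyLowerTailKnQuestion8CoefficientwiseRemSPPieces
import Summits.CriticalPhenomena.PercolationContinuityZ3.Theorems.PercNearOneGluingNoHeavyLowerTailKnQuestion8CoefficientwiseGluing
import Summits.CriticalPhenomena.PercolationContinuityZ3.Theorems.PercNearOneGluingNoHeavyLowerTailKnQuestion8CoefficientwiseTrivialCoreFlip
import HarnessLib

/-!
# THEOREM U3-CLOSURE, series step: the class `N` of a series composition in terms of the pieces — prim-lf-2 gen 69

Support file (`--supports stmt-CriticalPhenomena-4575`, closed), prover `prim-lf-2` (gen 69).  No definitions, no named facts, no sorries; standard axioms.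
Memo `prim-lf-2/CW-SP-gen69.md` §4.2 (SERIES) with the definitions of `…CoefficientwiseRemSPPieces.lean`.

Setting: disjoint edge sets `D₁` (terminals `x`, `m`) and `D₂` (terminals `m`, `h`), `x, m, h` pairwise distinct, whose edges share only the junction `m`, `x` on no edge
of `D₂`, `h` on no edge of `D₁`; `D = D₁ ∪ D₂` with terminals `x, h` (series composition); `C_a(s) = openCluster (ends '' s) a`.  By the one-vertex gluing lemma
`mem_openCluster_union_glue`: `C_x^D(s₁ ∪ s₂) = C_x(s₁) ∪ [m ∈ C_x s₁]·C_m(s₂)`, `C_x^D(D ∖ (s₁∪s₂)) = C_x(D₁∖s₁) ∪ [m ∈ C_x(D₁∖s₁)]·C_m(D₂∖s₂)`, and symmetrically from `h`.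
* `Coefficientwise.series_pieceN_iff` — for `s₁ ⊆ D₁`, `s₂ ⊆ D₂`: `s₁ ∪ s₂ ∈ pieceN(D; x, h)` iff ONE of: (α) `s₁ ∈ R0 ∪ R1` of `(D₁;x,m)`, `h ∉ C_m s₂`, and a
  witness (a target in `C_m s₂ ∩ C_h(D₂∖s₂)`, or `h ∈ C_m(D₂∖s₂)` together with `m ∈ W` or a target `≠ m` in `C_x s₁ ∩ C_m(D₁∖s₁)`); (β) `s₁` both-through without
  `x`-core and `s₂ ∈ pieceN(D₂; m, h)`; (γ₁) `s₁ ∈ pieceN(D₁;x,m)` and `h ∈ C_m(D₂∖s₂)`; (γ₂) `s₁` in the self-conjugate class `N011·` of `(D₁;x,m)`, `h ∈ C_m(D₂∖s₂)`,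
  `h ∉ C_m s₂`.
[cite: KozmaNitzan2024, Questions 8–9 (§5.5 p. 36) (context: the Question-8 pocket covariance programme)]
-/

namespace Summit.CriticalPhenomena.PercolationContinuityZ3.Theorems

open Finset Literature.Probability.Percolation

namespace Coefficientwise

variable {ι V : Type*} [DecidableEq ι] (ends : ι → Sym2 V)

open Classical in
/-- **The `N`-class of a series composition.**  See the module docstring for the four shapes. [cite: KozmaNitzan2024, Questions 8–9 (§5.5 p. 36) (context)] -/
theorem series_pieceN_iff {D₁ D₂ : Finset ι} (hdisj : Disjoint D₁ D₂) {x m h : V} (hxm : x ≠ m) (hmh : m ≠ h) (hxh : x ≠ h)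
    (hsep : ∀ e ∈ D₁, ∀ e' ∈ D₂, ∀ w : V, w ∈ ends e → w ∈ ends e' → w = m)
    (hxD₂ : ∀ e ∈ D₂, x ∉ ends e) (hhD₁ : ∀ e ∈ D₁, h ∉ ends e) (W : Set V)
    (s₁ : Finset ι) (hs₁ : s₁ ⊆ D₁) (s₂ : Finset ι) (hs₂ : s₂ ⊆ D₂) :
    pieceN ends (D₁ ∪ D₂) x h W (s₁ ∪ s₂) ↔
      ( ((pieceR0 ends D₁ x m W s₁ ∨ pieceR1 ends D₁ x m W s₁) ∧ h ∉ openCluster (ends '' (↑s₂ : Set ι)) m ∧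
          ((∃ w ∈ W, w ∈ openCluster (ends '' (↑s₂ : Set ι)) m ∧ w ∈ openCluster (ends '' (↑(D₂ \ s₂) : Set ι)) h) ∨
           (h ∈ openCluster (ends '' (↑(D₂ \ s₂) : Set ι)) m ∧
             (m ∈ W ∨ ∃ w ∈ W, w ≠ m ∧ w ∈ openCluster (ends '' (↑s₁ : Set ι)) x ∧ w ∈ openCluster (ends '' (↑(D₁ \ s₁) : Set ι)) m)))) ∨
        ((m ∈ openCluster (ends '' (↑s₁ : Set ι)) x ∧ m ∈ openCluster (ends '' (↑(D₁ \ s₁) : Set ι)) x ∧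
            ∀ w ∈ W, ¬ (w ∈ openCluster (ends '' (↑s₁ : Set ι)) x ∧ w ∈ openCluster (ends '' (↑(D₁ \ s₁) : Set ι)) x)) ∧
          pieceN ends D₂ m h W s₂) ∨
        (pieceN ends D₁ x m W s₁ ∧ h ∈ openCluster (ends '' (↑(D₂ \ s₂) : Set ι)) m) ∨
        ((m ∉ openCluster (ends '' (↑s₁ : Set ι)) x ∧ m ∉ openCluster (ends '' (↑(D₁ \ s₁) : Set ι)) x ∧
            (∀ w ∈ W, ¬ (w ∈ openCluster (ends '' (↑s₁ : Set ι)) x ∧ w ∈ openCluster (ends '' (↑(D₁ \ s₁) : Set ι)) x)) ∧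
            (∃ w ∈ W, w ≠ m ∧ w ∈ openCluster (ends '' (↑s₁ : Set ι)) x ∧ w ∈ openCluster (ends '' (↑(D₁ \ s₁) : Set ι)) m) ∧
            (∃ w ∈ W, w ∈ openCluster (ends '' (↑s₁ : Set ι)) m ∧ w ∈ openCluster (ends '' (↑(D₁ \ s₁) : Set ι)) x)) ∧
          h ∈ openCluster (ends '' (↑(D₂ \ s₂) : Set ι)) m ∧ h ∉ openCluster (ends '' (↑s₂ : Set ι)) m) ) := by
  set D : Finset ι := D₁ ∪ D₂ with hD
  set Cx : Finset ι → Set V := fun s => openCluster (ends '' (↑s : Set ι)) x with hCx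
  set Cm : Finset ι → Set V := fun s => openCluster (ends '' (↑s : Set ι)) m with hCm
  set Ch : Finset ι → Set V := fun s => openCluster (ends '' (↑s : Set ι)) h with hCh
  ------------------------------------------------------------------
  -- 0. gluing and elementary facts
  ------------------------------------------------------------------
  have GX : ∀ s₁, s₁ ⊆ D₁ → ∀ s₂, s₂ ⊆ D₂ → ∀ y, (y ∈ Cx (s₁ ∪ s₂) ↔ y ∈ Cx s₁ ∨ (m ∈ Cx s₁ ∧ y ∈ Cm s₂)) := by
    intro s₁ hs₁ s₂ hs₂ y
    exact mem_openCluster_union_glue ends (fun e he e' he' w hw hw' => hsep e (hs₁ he) e' (hs₂ he') w hw hw')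
      (fun e he hx => absurd hx (hxD₂ e (hs₂ he))) y
  have GH : ∀ s₁, s₁ ⊆ D₁ → ∀ s₂, s₂ ⊆ D₂ → ∀ y, (y ∈ Ch (s₁ ∪ s₂) ↔ y ∈ Ch s₂ ∨ (m ∈ Ch s₂ ∧ y ∈ Cm s₁)) := by
    intro s₁ hs₁ s₂ hs₂ y
    rw [Finset.union_comm]
    exact mem_openCluster_union_glue ends (fun e he e' he' w hw hw' => hsep e' (hs₁ he') e (hs₂ he) w hw' hw)
      (fun e he hh => absurd hh (hhD₁ e (hs₁ he))) y
  have h_notin_Cx1 : ∀ s₁, s₁ ⊆ D₁ → h ∉ Cx s₁ :=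
    fun s₁ hs₁ => not_mem_openCluster_of_forall_not_mem ends (fun e he => hhD₁ e (hs₁ he)) hxh.symm
  have h_notin_Cm1 : ∀ s₁, s₁ ⊆ D₁ → h ∉ Cm s₁ :=
    fun s₁ hs₁ => not_mem_openCluster_of_forall_not_mem ends (fun e he => hhD₁ e (hs₁ he)) hmh.symm
  have x_notin_Cm2 : ∀ s₂, s₂ ⊆ D₂ → x ∉ Cm s₂ :=
    fun s₂ hs₂ => not_mem_openCluster_of_forall_not_mem ends (fun e he => hxD₂ e (hs₂ he)) hxm
  have x_notin_Ch2 : ∀ s₂, s₂ ⊆ D₂ → x ∉ Ch s₂ :=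
    fun s₂ hs₂ => not_mem_openCluster_of_forall_not_mem ends (fun e he => hxD₂ e (hs₂ he)) hxh
  have mCh_iff : ∀ s₂ : Finset ι, m ∈ Ch s₂ ↔ h ∈ Cm s₂ := fun s₂ => mem_openCluster_comm ends s₂ h m
  -- decompositions
  have hdecomp : ∀ t, t ⊆ D → t = (t ∩ D₁) ∪ (t ∩ D₂) := by
    intro t ht; ext i
    simp only [Finset.mem_union, Finset.mem_inter]
    constructor
    · intro hi; rcases Finset.mem_union.mp (ht hi) with h1 | h2
      · exact Or.inl ⟨hi, h1⟩
      · exact Or.inr ⟨hi, h2⟩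
    · rintro (⟨hi, _⟩ | ⟨hi, _⟩) <;> exact hi
  have hsdiff : ∀ s₁, s₁ ⊆ D₁ → ∀ s₂, s₂ ⊆ D₂ → D \ (s₁ ∪ s₂) = (D₁ \ s₁) ∪ (D₂ \ s₂) :=
    fun s₁ hs₁ s₂ hs₂ => union_sdiff_union_of_subset hdisj hs₁ hs₂
  have hinter₁ : ∀ s₁, s₁ ⊆ D₁ → ∀ s₂, s₂ ⊆ D₂ → (s₁ ∪ s₂) ∩ D₁ = s₁ := by
    intro s₁ hs₁ s₂ hs₂; ext i
    simp only [Finset.mem_inter, Finset.mem_union]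
    constructor
    · rintro ⟨h12 | h12, hi1⟩
      · exact h12
      · exact absurd (Finset.mem_inter.mpr ⟨hi1, hs₂ h12⟩) (Finset.disjoint_iff_inter_eq_empty.mp hdisj ▸ Finset.notMem_empty i)
    · intro hi; exact ⟨Or.inl hi, hs₁ hi⟩
  have hinter₂ : ∀ s₁, s₁ ⊆ D₁ → ∀ s₂, s₂ ⊆ D₂ → (s₁ ∪ s₂) ∩ D₂ = s₂ := by
    intro s₁ hs₁ s₂ hs₂; ext i
    simp only [Finset.mem_inter, Finset.mem_union]
    constructor
    · rintro ⟨h12 | h12, hi2⟩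
      · exact absurd (Finset.mem_inter.mpr ⟨hs₁ h12, hi2⟩) (Finset.disjoint_iff_inter_eq_empty.mp hdisj ▸ Finset.notMem_empty i)
      · exact h12
    · intro hi; exact ⟨Or.inr hi, hs₂ hi⟩
  -- a vertex in a cluster of a D₁-colouring and in a cluster of a D₂-colouring is one of the seeds or the junction
  have cross : ∀ s₁, s₁ ⊆ D₁ → ∀ s₂, s₂ ⊆ D₂ → ∀ (a b w : V), w ∈ openCluster (ends '' (↑s₁ : Set ι)) a →
      w ∈ openCluster (ends '' (↑s₂ : Set ι)) b → w = a ∨ w = b ∨ w = m := by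
    intro s₁ hs₁ s₂ hs₂ a b w hwa hwb
    by_cases hwa' : w = a
    · exact Or.inl hwa'
    by_cases hwb' : w = b
    · exact Or.inr (Or.inl hwb')
    obtain ⟨e, he, hwe⟩ := exists_edge_of_mem_openCluster ends hwa hwa'
    obtain ⟨e', he', hwe'⟩ := exists_edge_of_mem_openCluster ends hwb hwb'
    exact Or.inr (Or.inr (hsep e (hs₁ he) e' (hs₂ he') w hwe hwe'))
  ------------------------------------------------------------------
  -- 1. component predicates (D₁ with terminals x,m; D₂ with terminals m,h) and their class dictionaries
  ------------------------------------------------------------------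
  -- D₁ side
  set a₁ : Finset ι → Prop := fun s => m ∈ Cx s with ha₁
  set b₁ : Finset ι → Prop := fun s => m ∈ Cx (D₁ \ s) with hb₁
  set NX₁ : Finset ι → Prop := fun s => ∀ w ∈ W, ¬ (w ∈ Cx s ∧ w ∈ Cx (D₁ \ s)) with hNX₁
  set FX₁ : Finset ι → Prop := fun s => ∃ w ∈ W, w ≠ m ∧ w ∈ Cx s ∧ w ∈ Cm (D₁ \ s) with hFX₁     -- f_xh of D₁ (targets ≠ m)
  set HX₁ : Finset ι → Prop := fun s => ∃ w ∈ W, w ∈ Cm s ∧ w ∈ Cx (D₁ \ s) with hHX₁             -- f_hx of D₁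
  -- classes of D₁ in these terms
  have R0₁_iff : ∀ s, pieceR0 ends D₁ x m W s ↔ (a₁ s ∧ ¬ b₁ s ∧ NX₁ s ∧ ¬ FX₁ s) := by
    intro s; unfold pieceR0
    exact ⟨fun ⟨p, q, r, u⟩ => ⟨p, q, r, fun ⟨w, hw, hne, h1, h2⟩ => u w hw hne ⟨h1, h2⟩⟩,
      fun ⟨p, q, r, u⟩ => ⟨p, q, r, fun w hw hne hh => u ⟨w, hw, hne, hh.1, hh.2⟩⟩⟩
  have R1₁_iff : ∀ s, pieceR1 ends D₁ x m W s ↔ (a₁ s ∧ ¬ b₁ s ∧ NX₁ s ∧ FX₁ s) := by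
    intro s; unfold pieceR1; exact Iff.rfl
  have N₁_iff : ∀ s, pieceN ends D₁ x m W s ↔ (¬ a₁ s ∧ ¬ b₁ s ∧ NX₁ s ∧ ¬ HX₁ s ∧ (∃ w ∈ W, w ∈ Cx s ∧ w ∈ Cm (D₁ \ s))) := by
    intro s; unfold pieceN
    exact ⟨fun ⟨p, q, r, u, v⟩ => ⟨p, q, r, fun ⟨w, hw, h1, h2⟩ => u w hw ⟨h1, h2⟩, v⟩,
      fun ⟨p, q, r, u, v⟩ => ⟨p, q, r, fun w hw hh => u ⟨w, hw, hh.1, hh.2⟩, v⟩⟩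
  -- when m ∉ Cx s, the existential flag of pieceN equals FX₁ (the witness cannot be m)
  have FX₁_iff : ∀ s, ¬ a₁ s → ((∃ w ∈ W, w ∈ Cx s ∧ w ∈ Cm (D₁ \ s)) ↔ FX₁ s) := by
    intro s hna
    exact ⟨fun ⟨w, hw, h1, h2⟩ => ⟨w, hw, fun hwm => hna (by simp only [ha₁]; rw [← hwm]; exact h1), h1, h2⟩, fun ⟨w, hw, _, h1, h2⟩ => ⟨w, hw, h1, h2⟩⟩
  -- D₂ side (terminals m, h)
  set a₂ : Finset ι → Prop := fun s => h ∈ Cm s with ha₂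
  set b₂ : Finset ι → Prop := fun s => h ∈ Cm (D₂ \ s) with hb₂
  set NX₂ : Finset ι → Prop := fun s => ∀ w ∈ W, ¬ (w ∈ Cm s ∧ w ∈ Cm (D₂ \ s)) with hNX₂
  set FX₂ : Finset ι → Prop := fun s => ∃ w ∈ W, w ≠ h ∧ w ∈ Cm s ∧ w ∈ Ch (D₂ \ s) with hFX₂
  set HX₂ : Finset ι → Prop := fun s => ∃ w ∈ W, w ∈ Ch s ∧ w ∈ Cm (D₂ \ s) with hHX₂
  have R0₂_iff : ∀ s, pieceR0 ends D₂ m h W s ↔ (a₂ s ∧ ¬ b₂ s ∧ NX₂ s ∧ ¬ FX₂ s) := by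
    intro s; unfold pieceR0
    exact ⟨fun ⟨p, q, r, u⟩ => ⟨p, q, r, fun ⟨w, hw, hne, h1, h2⟩ => u w hw hne ⟨h1, h2⟩⟩,
      fun ⟨p, q, r, u⟩ => ⟨p, q, r, fun w hw hne hh => u ⟨w, hw, hne, hh.1, hh.2⟩⟩⟩
  have R1₂_iff : ∀ s, pieceR1 ends D₂ m h W s ↔ (a₂ s ∧ ¬ b₂ s ∧ NX₂ s ∧ FX₂ s) := by
    intro s; unfold pieceR1; exact Iff.rfl
  have N₂_iff : ∀ s, pieceN ends D₂ m h W s ↔ (¬ a₂ s ∧ ¬ b₂ s ∧ NX₂ s ∧ ¬ HX₂ s ∧ (∃ w ∈ W, w ∈ Cm s ∧ w ∈ Ch (D₂ \ s))) := by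
    intro s; unfold pieceN
    exact ⟨fun ⟨p, q, r, u, v⟩ => ⟨p, q, r, fun ⟨w, hw, h1, h2⟩ => u w hw ⟨h1, h2⟩, v⟩,
      fun ⟨p, q, r, u, v⟩ => ⟨p, q, r, fun w hw hh => u ⟨w, hw, hh.1, hh.2⟩, v⟩⟩
  ------------------------------------------------------------------
  -- the class Z0 of D₁ (both-through, no x-core) and the class N011 of D₁
  set Z0₁ : Finset ι → Prop := fun s => a₁ s ∧ b₁ s ∧ NX₁ s with hZ0₁
  set M₁ : Finset ι → Prop := fun s => ¬ a₁ s ∧ ¬ b₁ s ∧ NX₁ s ∧ FX₁ s ∧ HX₁ s with hM₁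
  -- 4. CASE ANALYSIS of a composite colouring.  For t ⊆ D put t₁ = t ∩ D₁, t₂ = t ∩ D₂.
  --    Shape lemma: the conditions "h ∉ Cx^D(D∖t)" and "no x-core" and the classes of t₁.
  ------------------------------------------------------------------
  -- the composite clusters
  have CxD : ∀ s₁, s₁ ⊆ D₁ → ∀ s₂, s₂ ⊆ D₂ → ∀ y, (y ∈ Cx (s₁ ∪ s₂) ↔ y ∈ Cx s₁ ∨ (a₁ s₁ ∧ y ∈ Cm s₂)) := fun s₁ hs₁ s₂ hs₂ y => GX s₁ hs₁ s₂ hs₂ y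
  have CxDc : ∀ s₁, s₁ ⊆ D₁ → ∀ s₂, s₂ ⊆ D₂ → ∀ y, (y ∈ Cx (D \ (s₁ ∪ s₂)) ↔ y ∈ Cx (D₁ \ s₁) ∨ (b₁ s₁ ∧ y ∈ Cm (D₂ \ s₂))) := by
    intro s₁ hs₁ s₂ hs₂ y; rw [hsdiff s₁ hs₁ s₂ hs₂]; exact GX _ Finset.sdiff_subset _ Finset.sdiff_subset y
  have ChD : ∀ s₁, s₁ ⊆ D₁ → ∀ s₂, s₂ ⊆ D₂ → ∀ y, (y ∈ Ch (s₁ ∪ s₂) ↔ y ∈ Ch s₂ ∨ (a₂ s₂ ∧ y ∈ Cm s₁)) := by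
    intro s₁ hs₁ s₂ hs₂ y; rw [GH s₁ hs₁ s₂ hs₂ y, mCh_iff]
  have ChDc : ∀ s₁, s₁ ⊆ D₁ → ∀ s₂, s₂ ⊆ D₂ → ∀ y, (y ∈ Ch (D \ (s₁ ∪ s₂)) ↔ y ∈ Ch (D₂ \ s₂) ∨ (b₂ s₂ ∧ y ∈ Cm (D₁ \ s₁))) := by
    intro s₁ hs₁ s₂ hs₂ y; rw [hsdiff s₁ hs₁ s₂ hs₂, GH _ Finset.sdiff_subset _ Finset.sdiff_subset y, mCh_iff]
  -- h ∈ Cx(s₁∪s₂) ↔ a₁ ∧ a₂ ;  h ∈ Cx(D∖…) ↔ b₁ ∧ b₂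
  have hK_iff : ∀ s₁, s₁ ⊆ D₁ → ∀ s₂, s₂ ⊆ D₂ → (h ∈ Cx (s₁ ∪ s₂) ↔ (a₁ s₁ ∧ a₂ s₂)) := by
    intro s₁ hs₁ s₂ hs₂; rw [CxD s₁ hs₁ s₂ hs₂]
    exact ⟨fun hh => hh.elim (fun h1 => absurd h1 (h_notin_Cx1 s₁ hs₁)) id, Or.inr⟩
  have hB_iff : ∀ s₁, s₁ ⊆ D₁ → ∀ s₂, s₂ ⊆ D₂ → (h ∈ Cx (D \ (s₁ ∪ s₂)) ↔ (b₁ s₁ ∧ b₂ s₂)) := by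
    intro s₁ hs₁ s₂ hs₂; rw [CxDc s₁ hs₁ s₂ hs₂]
    exact ⟨fun hh => hh.elim (fun h1 => absurd h1 (h_notin_Cx1 _ Finset.sdiff_subset)) id, Or.inr⟩
  ------------------------------------------------------------------
  -- 5. The N-class of the composite: characterisation by cases on t₁
  ------------------------------------------------------------------
  -- composite N: h ∉ Cx t, h ∉ Cx(D∖t), NX, NHX, XH.  Three shapes:
  --  (α) t₁ ∈ R0₁ ∪ R1₁ (a₁, ¬b₁), t₂ with ¬a₂ and the D₂-conditions 'XHcomp';
  --  (β) t₁ ∈ Z0₁, t₂ ∈ pieceN₂;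
  --  (γ) ¬a₁, ¬b₁: t₁ ∈ pieceN₁ or t₁ ∈ M₁, with b₂ and (a₂ → ¬HX₁ t₁).
  -- We prove: membership ⇒ one of the shapes (with the data needed), and each shape (with that data) ⇒ membership.
  have N_shape : ∀ t, t ⊆ D → pieceN ends D x h W t →
      ( (a₁ (t ∩ D₁) ∧ ¬ b₁ (t ∩ D₁) ∧ NX₁ (t ∩ D₁) ∧ ¬ a₂ (t ∩ D₂)) ∨
        (Z0₁ (t ∩ D₁) ∧ pieceN ends D₂ m h W (t ∩ D₂)) ∨
        (¬ a₁ (t ∩ D₁) ∧ ¬ b₁ (t ∩ D₁) ∧ NX₁ (t ∩ D₁) ∧ FX₁ (t ∩ D₁) ∧ b₂ (t ∩ D₂) ∧ (a₂ (t ∩ D₂) → ¬ HX₁ (t ∩ D₁))) ) := by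
    intro t ht hN
    set t₁ := t ∩ D₁ with ht₁
    set t₂ := t ∩ D₂ with ht₂
    have ht₁D : t₁ ⊆ D₁ := Finset.inter_subset_right
    have ht₂D : t₂ ⊆ D₂ := Finset.inter_subset_right
    have htt : t = t₁ ∪ t₂ := hdecomp t ht
    obtain ⟨hhK, hhB, hNX, hNHX, ⟨w0, hw0, hw0K, hw0P⟩⟩ := hN
    rw [htt] at hhK hhB hNX hNHX hw0K hw0P
    have hK := hK_iff t₁ ht₁D t₂ ht₂D
    have hB := hB_iff t₁ ht₁D t₂ ht₂D
    -- no x-core inside D₁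
    have NX1 : NX₁ t₁ := fun w hw hh =>
      hNX w hw ⟨(CxD t₁ ht₁D t₂ ht₂D w).mpr (Or.inl hh.1), (CxDc t₁ ht₁D t₂ ht₂D w).mpr (Or.inl hh.2)⟩
    by_cases hA1 : a₁ t₁
    · by_cases hB1 : b₁ t₁
      · -- (β): Z0 and t₂ ∈ pieceN₂
        right; left
        have hna2 : ¬ a₂ t₂ := fun h2 => hhK (hK.mpr ⟨hA1, h2⟩)
        have hnb2 : ¬ b₂ t₂ := fun h2 => hhB (hB.mpr ⟨hB1, h2⟩)
        refine ⟨⟨hA1, hB1, NX1⟩, (N₂_iff t₂).mpr ⟨hna2, hnb2, ?_, ?_, ?_⟩⟩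
        · intro w hw hh
          exact hNX w hw ⟨(CxD t₁ ht₁D t₂ ht₂D w).mpr (Or.inr ⟨hA1, hh.1⟩), (CxDc t₁ ht₁D t₂ ht₂D w).mpr (Or.inr ⟨hB1, hh.2⟩)⟩
        · rintro ⟨w, hw, hwP, hwB⟩
          exact hNHX w hw ⟨(ChD t₁ ht₁D t₂ ht₂D w).mpr (Or.inl hwP), (CxDc t₁ ht₁D t₂ ht₂D w).mpr (Or.inr ⟨hB1, hwB⟩)⟩
        · -- the witness w0 lies in D₂
          rcases (ChDc t₁ ht₁D t₂ ht₂D w0).mp hw0P with hP2 | ⟨hb2, _⟩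
          · rcases (CxD t₁ ht₁D t₂ ht₂D w0).mp hw0K with hK1 | ⟨_, hK2⟩
            · -- w0 ∈ Cx t₁ ∩ Ch(D₂∖t₂): w0 = m, but then m ∈ Ch(D₂∖t₂) = b₂, excluded
              rcases cross t₁ ht₁D (D₂ \ t₂) Finset.sdiff_subset x h w0 hK1 hP2 with rfl | rfl | rfl
              · exact absurd hP2 (x_notin_Ch2 _ Finset.sdiff_subset)
              · exact absurd hK1 (h_notin_Cx1 t₁ ht₁D)
              · exact absurd ((mCh_iff _).mp hP2) hnb2
            · exact ⟨w0, hw0, hK2, hP2⟩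
          · exact absurd hb2 hnb2
      · -- (α)
        left
        exact ⟨hA1, hB1, NX1, fun h2 => hhK (hK.mpr ⟨hA1, h2⟩)⟩
    · -- ¬a₁: then XH forces b₂ ∧ FX₁, and ¬b₁
      right; right
      -- the witness: w0 ∈ Cx(t₁∪t₂) = Cx t₁ (¬a₁); w0 ∈ Ch(D∖t) = Ch(D₂∖t₂) ∪ [b₂] Cm(D₁∖t₁)
      have hw0K1 : w0 ∈ Cx t₁ := by
        rcases (CxD t₁ ht₁D t₂ ht₂D w0).mp hw0K with h1 | ⟨ha, _⟩
        · exact h1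
        · exact absurd ha hA1
      have key : b₂ t₂ ∧ w0 ∈ Cm (D₁ \ t₁) := by
        rcases (ChDc t₁ ht₁D t₂ ht₂D w0).mp hw0P with hP2 | ⟨hb2, hP1⟩
        · rcases cross t₁ ht₁D (D₂ \ t₂) Finset.sdiff_subset x h w0 hw0K1 hP2 with rfl | rfl | rfl
          · exact absurd hP2 (x_notin_Ch2 _ Finset.sdiff_subset)
          · exact absurd hw0K1 (h_notin_Cx1 t₁ ht₁D)
          · exact absurd hw0K1 hA1
        · exact ⟨hb2, hP1⟩
      obtain ⟨hb2, hw0P1⟩ := key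
      have hB1 : ¬ b₁ t₁ := fun h1 => hhB (hB.mpr ⟨h1, hb2⟩)
      have hw0m : w0 ≠ m := fun hwm => hA1 (by simp only [ha₁]; rw [← hwm]; exact hw0K1)
      refine ⟨hA1, hB1, NX1, ⟨w0, hw0, hw0m, hw0K1, hw0P1⟩, hb2, fun ha2 => ?_⟩
      rintro ⟨w, hw, hwM, hwB⟩
      exact hNHX w hw ⟨(ChD t₁ ht₁D t₂ ht₂D w).mpr (Or.inr ⟨ha2, hwM⟩), (CxDc t₁ ht₁D t₂ ht₂D w).mpr (Or.inl hwB)⟩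
  -- the D₂-data carried along in shape (α): we simply keep t₂, so we record the composite conditions as a predicate on (s₁, t₂) that only depends on
  -- s₁ through (a₁ s₁, ¬ b₁ s₁, NX₁ s₁, FX₁ s₁).  Converse builder for all shapes:
  have N_build : ∀ s₁, s₁ ⊆ D₁ → ∀ s₂, s₂ ⊆ D₂ → NX₁ s₁ → ¬ b₁ s₁ ∨ Z0₁ s₁ →
      -- h conditions
      ¬ (a₁ s₁ ∧ a₂ s₂) → ¬ (b₁ s₁ ∧ b₂ s₂) →
      -- D₂ no-core conditions when reachable
      (a₁ s₁ → b₁ s₁ → NX₂ s₂) → (b₁ s₁ → ¬ HX₂ s₂) →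
      -- D₁ h-x condition
      (a₂ s₂ → ¬ HX₁ s₁) →
      -- a witness
      ((a₁ s₁ ∧ ∃ w ∈ W, w ∈ Cm s₂ ∧ w ∈ Ch (D₂ \ s₂)) ∨ (b₂ s₂ ∧ ∃ w ∈ W, w ∈ Cx s₁ ∧ w ∈ Cm (D₁ \ s₁))) →
      pieceN ends D x h W (s₁ ∪ s₂) := by
    intro s₁ hs₁ s₂ hs₂ hNX1 hshape hna hnb hNX2 hNHX2 hNHX1 hwit
    have hxW : x ∉ W := fun hxW => hNX1 x hxW ⟨mem_openCluster_self _ x, mem_openCluster_self _ x⟩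
    have hmW_of : a₁ s₁ → b₁ s₁ → m ∉ W := fun ha hb hmW => hNX1 m hmW ⟨ha, hb⟩
    refine ⟨fun hh => hna ((hK_iff s₁ hs₁ s₂ hs₂).mp hh), fun hh => hnb ((hB_iff s₁ hs₁ s₂ hs₂).mp hh), ?_, ?_, ?_⟩
    · -- NX
      intro w hw hh
      obtain ⟨hwK, hwB⟩ := hh
      rcases (CxD s₁ hs₁ s₂ hs₂ w).mp hwK with k1 | ⟨ha, k2⟩ <;> rcases (CxDc s₁ hs₁ s₂ hs₂ w).mp hwB with l1 | ⟨hb, l2⟩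
      · exact hNX1 w hw ⟨k1, l1⟩
      · rcases cross s₁ hs₁ (D₂ \ s₂) Finset.sdiff_subset x m w k1 l2 with rfl | rfl | rfl
        · exact hxW hw
        · exact hNX1 w hw ⟨k1, hb⟩
        · exact hNX1 w hw ⟨k1, hb⟩
      · rcases cross (D₁ \ s₁) Finset.sdiff_subset s₂ hs₂ x m w l1 k2 with rfl | rfl | rfl
        · exact hxW hw
        · exact hNX1 w hw ⟨ha, l1⟩
        · exact hNX1 w hw ⟨ha, l1⟩
      · exact hNX2 ha hb w hw ⟨k2, l2⟩
    · -- NHX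
      intro w hw hh
      obtain ⟨hwP, hwB⟩ := hh
      rcases (ChD s₁ hs₁ s₂ hs₂ w).mp hwP with p2 | ⟨ha2, p1⟩ <;> rcases (CxDc s₁ hs₁ s₂ hs₂ w).mp hwB with l1 | ⟨hb, l2⟩
      · rcases cross (D₁ \ s₁) Finset.sdiff_subset s₂ hs₂ x h w l1 p2 with hwx | hwh' | hwm
        · exact hxW (hwx ▸ hw)
        · exact h_notin_Cx1 _ Finset.sdiff_subset (by rw [← hwh']; exact l1)
        · have hmW : m ∈ W := hwm ▸ hw
          have ha2 : a₂ s₂ := (mCh_iff s₂).mp (by rw [← hwm]; exact p2)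
          have hb1 : m ∈ Cx (D₁ \ s₁) := by rw [← hwm]; exact l1
          exact hNHX1 ha2 ⟨m, hmW, mem_openCluster_self _ m, hb1⟩
      · exact hNHX2 hb ⟨w, hw, p2, l2⟩
      · exact hNHX1 ha2 ⟨w, hw, p1, l1⟩
      · rcases cross s₁ hs₁ (D₂ \ s₂) Finset.sdiff_subset m m w p1 l2 with hwm | hwm | hwm <;>
        · have hmW : m ∈ W := hwm ▸ hw
          exact hNHX1 ha2 ⟨m, hmW, mem_openCluster_self _ m, hb⟩
    · -- XH
      rcases hwit with ⟨ha, w, hw, hwM, hwP⟩ | ⟨hb2, w, hw, hwK, hwP⟩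
      · exact ⟨w, hw, (CxD s₁ hs₁ s₂ hs₂ w).mpr (Or.inr ⟨ha, hwM⟩), (ChDc s₁ hs₁ s₂ hs₂ w).mpr (Or.inl hwP)⟩
      · exact ⟨w, hw, (CxD s₁ hs₁ s₂ hs₂ w).mpr (Or.inl hwK), (ChDc s₁ hs₁ s₂ hs₂ w).mpr (Or.inr ⟨hb2, hwP⟩)⟩
  ------------------------------------------------------------------
  ------------------------------------------------------------------
  -- the iff
  ------------------------------------------------------------------
  have h12 : s₁ ∪ s₂ ⊆ D := Finset.union_subset_union hs₁ hs₂
  have e1 : (s₁ ∪ s₂) ∩ D₁ = s₁ := hinter₁ s₁ hs₁ s₂ hs₂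
  have e2 : (s₁ ∪ s₂) ∩ D₂ = s₂ := hinter₂ s₁ hs₁ s₂ hs₂
  constructor
  · intro hN
    have hsh := N_shape (s₁ ∪ s₂) h12 hN
    rw [e1, e2] at hsh
    -- data for the witness in case (α)
    obtain ⟨hhK, hhB, hNX, hNHX, hXH⟩ := hN
    rcases hsh with ⟨hA1, hnb1, hNX1, hna2⟩ | ⟨hz, hN2⟩ | ⟨hna1, hnb1, hNX1, hF1, hb2, hhx⟩
    · left
      have hcls : pieceR0 ends D₁ x m W s₁ ∨ pieceR1 ends D₁ x m W s₁ := by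
        by_cases hF1 : FX₁ s₁
        · exact Or.inr ((R1₁_iff s₁).mpr ⟨hA1, hnb1, hNX1, hF1⟩)
        · exact Or.inl ((R0₁_iff s₁).mpr ⟨hA1, hnb1, hNX1, hF1⟩)
      refine ⟨hcls, hna2, ?_⟩
      obtain ⟨w, hw, hwK, hwP⟩ := hXH
      rcases (CxD s₁ hs₁ s₂ hs₂ w).mp hwK with k1 | ⟨_, k2⟩ <;> rcases (ChDc s₁ hs₁ s₂ hs₂ w).mp hwP with p2 | ⟨hb2, p1⟩
      · rcases cross s₁ hs₁ (D₂ \ s₂) Finset.sdiff_subset x h w k1 p2 with hwx | hwh | hwm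
        · exact absurd (hwx ▸ p2) (x_notin_Ch2 _ Finset.sdiff_subset)
        · exact absurd (hwh ▸ k1) (h_notin_Cx1 s₁ hs₁)
        · exact Or.inr ⟨(mCh_iff _).mp (by rw [← hwm]; exact p2), Or.inl (hwm ▸ hw)⟩
      · by_cases hwm : w = m
        · exact Or.inr ⟨hb2, Or.inl (hwm ▸ hw)⟩
        · exact Or.inr ⟨hb2, Or.inr ⟨w, hw, hwm, k1, p1⟩⟩
      · exact Or.inl ⟨w, hw, k2, p2⟩
      · rcases cross (D₁ \ s₁) Finset.sdiff_subset s₂ hs₂ m m w p1 k2 with hwm | hwm | hwm <;>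
          exact Or.inr ⟨hb2, Or.inl (hwm ▸ hw)⟩
    · exact Or.inr (Or.inl ⟨hz, hN2⟩)
    · by_cases hHX : HX₁ s₁
      · exact Or.inr (Or.inr (Or.inr ⟨⟨hna1, hnb1, hNX1, hF1, hHX⟩, hb2, fun ha2 => hhx ha2 hHX⟩))
      · exact Or.inr (Or.inr (Or.inl ⟨(N₁_iff s₁).mpr ⟨hna1, hnb1, hNX1, hHX, (FX₁_iff s₁ hna1).mpr hF1⟩, hb2⟩))
  · rintro (⟨hcls, hna2, hwit⟩ | ⟨hz, hN2⟩ | ⟨hN1, hb2⟩ | ⟨hM, hb2, hna2⟩)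
    · -- (α)
      have hdat : a₁ s₁ ∧ ¬ b₁ s₁ ∧ NX₁ s₁ := by
        rcases hcls with h0 | h1
        · obtain ⟨p, q, r, _⟩ := (R0₁_iff s₁).mp h0; exact ⟨p, q, r⟩
        · obtain ⟨p, q, r, _⟩ := (R1₁_iff s₁).mp h1; exact ⟨p, q, r⟩
      obtain ⟨hA1, hnb1, hNX1⟩ := hdat
      refine N_build s₁ hs₁ s₂ hs₂ hNX1 (Or.inl hnb1) (fun hh => hna2 hh.2) (fun hh => hnb1 hh.1)
        (fun _ hb => absurd hb hnb1) (fun hb => absurd hb hnb1) (fun ha2 => absurd ha2 hna2) ?_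
      rcases hwit with hw2 | ⟨hb2, hmW | ⟨w, hw, _, hwK, hwP⟩⟩
      · exact Or.inl ⟨hA1, hw2⟩
      · exact Or.inr ⟨hb2, m, hmW, hA1, mem_openCluster_self _ m⟩
      · exact Or.inr ⟨hb2, w, hw, hwK, hwP⟩
    · -- (β)
      obtain ⟨hna2, hnb2, hNX2, hnHX2, hX2⟩ := (N₂_iff s₂).mp hN2
      exact N_build s₁ hs₁ s₂ hs₂ hz.2.2 (Or.inr hz) (fun hh => hna2 hh.2) (fun hh => hnb2 hh.2)
        (fun _ _ => hNX2) (fun _ => hnHX2) (fun ha2 => absurd ha2 hna2) (Or.inl ⟨hz.1, hX2⟩)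
    · -- (γ₁)
      obtain ⟨hna1, hnb1, hNX1, hnHX1, hX1⟩ := (N₁_iff s₁).mp hN1
      exact N_build s₁ hs₁ s₂ hs₂ hNX1 (Or.inl hnb1) (fun hh => hna1 hh.1) (fun hh => hnb1 hh.1)
        (fun ha => absurd ha hna1) (fun hb => absurd hb hnb1) (fun _ => hnHX1) (Or.inr ⟨hb2, hX1⟩)
    · -- (γ₂)
      obtain ⟨hna1, hnb1, hNX1, ⟨w, hw, _, hwK, hwP⟩, _⟩ := hM
      exact N_build s₁ hs₁ s₂ hs₂ hNX1 (Or.inl hnb1) (fun hh => hna1 hh.1) (fun hh => hnb1 hh.1)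
        (fun ha => absurd ha hna1) (fun hb => absurd hb hnb1) (fun ha2 => absurd ha2 hna2) (Or.inr ⟨hb2, w, hw, hwK, hwP⟩)

end Coefficientwise

end Summit.CriticalPhenomena.PercolationContinuityZ3.Theorems
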